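import Summits.Langlands.Langlands.Theses.SchurDefectSplit

/-!
# Route SchurDefectSplit — Assembly

The assembly item (stmt-Langlands-27237) of the child route `SchurDefectSplit` (decomp-langlands lens-5 gen 14; a gate-native D-0170
refining child: `--refines route-Langlands-ExtendedAdequacySplit:CoreIrreducibleNonProductLifting`, edge split, depth 1, no FRAME item) for the
declared residual CORE′ = `ExtendedAdequacySplit.CoreIrreducibleNonProductLifting` (stmt-Langlands-27082):
`SchurDefectLayerLifting → LinearDefectLifting → ExtendedAdequacySplit.CoreIrreducibleNonProductLifting`.

This is literally the type of the route file's sorry-free deciding theorem `Summit.Langlands.Langlands.Theses.SchurDefectSplit.closes`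
(one excluded middle on linear adequacy of the perfect core).  Nothing here proves `Langlands` (nor CORE′): the assembly records only that the two
ledger items of the route, taken together, imply the refined residual.
-/

set_option linter.dupNamespace false -- project-wide option (lakefile weak.linter.dupNamespace); `Summit.Langlands.Langlands` is the mandated namespace

namespace Summit.Langlands.Langlands.Theorems

/-- **Assembly of route SchurDefectSplit** (stmt-Langlands-27237): `SCH → LDF → ExtendedAdequacySplit.CoreIrreducibleNonProductLifting`.
Proof: unfold `Assembly` and apply the route's deciding theorem `Theses.SchurDefectSplit.closes`. -/
theorem schurDefectSplit_assembly_proof :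
    Summit.Langlands.Langlands.Theses.SchurDefectSplit.Assembly := by
  unfold Summit.Langlands.Langlands.Theses.SchurDefectSplit.Assembly
  exact Summit.Langlands.Langlands.Theses.SchurDefectSplit.closes

end Summit.Langlands.Langlands.Theorems
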